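import Summits.QuantumFields.BalabanUV.Beta.GAN24.StencilSlotVH
import Summits.QuantumFields.BalabanUV.Beta.GAN24.StencilSlotLam

/-!
# `BalabanUV.Beta.GAN24.StencilSlotOfShapes` — binder row G-an2-4 / (CONV-C), AFTER the K-slot: the wall's STENCIL binder `hS`
# (uniform half of the S-slot) PROVED AS A FUNCTION OF the K-slot's decay half `UnitDecayK` AND ONE LOCATED SHAPE («E3Shape»)
# (the value-function third-jet summand) — the S-slot analogue of `GAN24/ConvCKOfShapes` (note `HOME/b2b-balaban-gan24-p1/S-SLOT.md` §5)

NOT IN PRINT; OUR PROOF ATTEMPT (row owner b2b-balaban-gan24-p1, gen 3).  HONEST FRAMING (cell contract, verbatim): «discharging `BetaPertH`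
makes Bałaban's UV stability UNCONDITIONAL — a real constructive-QFT result; it is NOT the continuum limit and NOT the Clay problem.»
HONEST DEPENDENCY (verbatim): «continuum YM on T⁴ ⇐ BetaPertH ∧ nine spine estimates (0/9 proved); BetaPertH ⇐ (D1) ∧ (D4) ∧ CAP+tail;
G-an2-4 gates asym, D1 and NE2/3/4.»  [folklore] bookkeeping: composition of the landed pieces `GAN24/StencilSlotVH` (p203951) and
`GAN24/StencilSlotLam` (p204120) with an2's `JsBal0Of_S_zero/_succ`, `BalabanStepJets.locStencil_S0` and the additivity of `unitS`; no estimate,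
no cited fact, no `def`, no `Prop` mirror.  The located remainder of the S-slot enters as the INLINE HYPOTHESIS `hE3` («E3Shape» in S-SLOT.md §5:
the `j`-uniform locality of the normalised value-function third-jet summand of the composites, i.e. fine-level columns of `KInv (Lc^j)` +
BCJ's `Sc (j−1)` — NOT IN PRINT for the typed objects, NOT covered by road P1 as landed; asserted nowhere).
NOTHING of the wall is discharged here: its binder `hS` is concluded only FROM the hypothesis «E3Shape» (open) and `UnitDecayK` (= the wall's own `hK`;
for `d = 3` a theorem of road P1, `GAN24/FibreStrip.unitDecayK_holds` p203939 — not imported here, the file stays generic in `d`); the Cauchy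
half `hSall`, the second-order binders `(hW, hWall)` and the identification are untouched.  0 wall binders instantiated.  NOT summit progress.

## What is proved (generic `d`; `Lc` with `NeZero Lc`, `1 ≤ Lc`)
* hypothesis «E3Shape» `hE3 : ∀ j, LocStencil (unitS (sfStep Lc (j+1)) (smStep d Lc (j+1)) (fun κ u ↦ (cE * wE d Lc (j+1)) • e3Of d Lc cE cVH cΛ (j+1) κ u)) C₃ δ₃`
  — the `j`-UNIFORM locality of the normalised (P-E‴) summand of an2's step stencils (inline hypothesis; asserted nowhere).
* algebra: `unitS_add` (the change of units is additive over stencil families), `unitS_Sstep_succ_eq` (the normalised member `j+1` is the sum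
  of its three normalised summands, `Sstep` unfolded by `rfl`), `locStencil_const_mono`, `sfStep_zero`/`smStep_zero`, `unitS_step_zero`
  (member `0` is read in unit `1`: `unitS (sfStep Lc 0) (smStep d Lc 0) S = S`).
* **`locStencil_unitS_Sstep_succ`**: `UnitDecayK … C δ → 0 < δ → «E3Shape» C₃ δ₃ → 0 < δ₃ → ∀ j, LocStencil (unitS_{j+1} (Sstep … (j+1))) Ctot δtot`
  with ONE explicit `j`-free `Ctot = C₃ + |cVH|·3ℓ²e^{4(d+1)Lc·δtot} + CΛ(C, δ)` and `δtot = min δ₃ (δ/4)` — members `≥ 1`.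
* **`hS_of_shapes`** — THE WALL'S BINDER SHAPE: `UnitDecayK d Lc (sfStep Lc) (smStep d Lc) C δ → 0 < δ → «E3Shape» C₃ δ₃ → 0 < δ₃ →
  ∃ Cs δS, 0 < δS ∧ ∀ j, LocStencil (unitS (sfStep Lc j) (smStep d Lc j) (JsBal0Of hLc cE cVH cΛ W Cw δw hδw hW j).S) Cs δS`
  — LITERALLY the hypothesis `hS` of `HessKerDressedUnitsWall.d1Drift_JsBalOf_iff_of_cauchy_unit` at `sf := sfStep Lc`, `sm := smStep d Lc`
  (member `0` = `S0` joins with its own per-`Lc` constant, `locStencil_S0`; all members `≥ 1` share the uniform one).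
So the S-slot's uniform half reads: `hS ⇐ hK ∧ E3Shape` in the kernel; what remains located is «E3Shape» (and, for `hSall`, its drift twin).
-/

noncomputable section

open Literature.MathematicalPhysics.QuantumFieldTheory
open Literature.MathematicalPhysics.QuantumFieldTheory.Balaban1983to89
open Literature.MathematicalPhysics.QuantumFieldTheory.Balaban1983to89.Beta
open B12Sec2to5 (l1 l1_nonneg)
open ExpKernelCalculus (MKer Decays BiLoc VertexFamily₂ Zl Zl_nonneg)
open OneStepResolventKernel (Fib LocStencil)
open OneStepKernelFamily (KInvStep)
open InterLevelTransport (SLam)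
open AveragingHessianKernels (vhS hessFF ell)
open StepJetData (mfNeg)
open BalabanStepJets (S0 locStencil_S0)
open BalabanStepJetsSucc (wE wVH wΛ e3Of E2 lamCoeffK Sstep JsBal0Of JsBal0Of_S_zero JsBal0Of_S_succ)
open Summit.QuantumFields.BalabanUV.Beta.HessKerDressedUnits (unitK unitS unitS_apply unitS_one)
open Summit.QuantumFields.BalabanUV.Beta.GAN24.CombesThomas (sfStep smStep KStepUnit UnitDecayK)
open Summit.QuantumFields.BalabanUV.Beta.GAN24.StencilSlotVH (locStencil_unitS_vhPiece)
open Summit.QuantumFields.BalabanUV.Beta.GAN24.StencilSlotLam (locStencil_unitS_lamPiece)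

namespace Summit.QuantumFields.BalabanUV.Beta.GAN24.StencilSlotOfShapes

variable {d : ℕ}

/-! ## §1 The located shape and the bookkeeping lemmas -/

/-- [folklore] The change of units of stencil tables is ADDITIVE. -/
theorem unitS_add (sf sm : ℝ) (A B : Fin (d + 1) → (Fin (d + 1) → ℤ) → MKer (d + 1) (Fib d)) :
    unitS sf sm (fun κ u => A κ u + B κ u) = fun κ u => unitS sf sm A κ u + unitS sf sm B κ u := by
  funext κ u x y a b
  simp only [unitS_apply, Pi.add_apply]
  ring

/-- [folklore] A local stencil family admits any larger constant. -/
theorem locStencil_const_mono {S : Fin (d + 1) → (Fin (d + 1) → ℤ) → MKer (d + 1) (Fib d)} {C C' δ : ℝ}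
    (h : LocStencil S C δ) (hC : C ≤ C') : LocStencil S C' δ :=
  fun κ u x y a b => (h κ u x y a b).trans (mul_le_mul_of_nonneg_right hC (Real.exp_pos _).le)

/-- [folklore] A local stencil family at a smaller rate and a larger constant. -/
theorem locStencil_mono' {S : Fin (d + 1) → (Fin (d + 1) → ℤ) → MKer (d + 1) (Fib d)} {C C' δ δ' : ℝ}
    (h : LocStencil S C δ) (hC : C ≤ C') (hδ : δ' ≤ δ) : LocStencil S C' δ' := by
  have hC0 : 0 ≤ C := (h 0 0).nonneg (Sum.inl 0)
  intro κ u x y a b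
  refine ((h κ u x y a b).trans ?_).trans (mul_le_mul_of_nonneg_right hC (Real.exp_pos _).le)
  refine mul_le_mul_of_nonneg_left (Real.exp_le_exp.2 ?_) hC0
  have := add_nonneg (l1_nonneg (x - u)) (l1_nonneg (y - u))
  nlinarith

section Family

variable {Lc : ℕ} [NeZero Lc]

/-- [folklore] Member `j+1` of an2's stencil family, normalised, is the SUM of its three normalised summands (`Sstep` unfolded by `rfl`). -/
theorem unitS_Sstep_succ_eq (cE cVH cΛ : ℝ) (j : ℕ) :
    unitS (sfStep Lc (j + 1)) (smStep d Lc (j + 1)) (Sstep d Lc cE cVH cΛ (j + 1)) = fun κ u =>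
      unitS (sfStep Lc (j + 1)) (smStep d Lc (j + 1)) (fun κ u => (cE * wE d Lc (j + 1)) • e3Of d Lc cE cVH cΛ (j + 1) κ u) κ u +
      unitS (sfStep Lc (j + 1)) (smStep d Lc (j + 1)) (fun κ u => (cVH * wVH d Lc (j + 1)) • mfNeg (vhS d Lc κ u)) κ u +
      unitS (sfStep Lc (j + 1)) (smStep d Lc (j + 1))
        (fun κ u => (cΛ * wΛ d Lc (j + 1)) •
          SLam Lc (lamCoeffK (KInvStep (d := d) Lc (j + 1)) (E2 d Lc (j + 1)) Lc) (fun μ y => hessFF Lc μ y) κ u) κ u := by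
  have h : Sstep d Lc cE cVH cΛ (j + 1) = fun κ u =>
      ((fun κ u => (cE * wE d Lc (j + 1)) • e3Of d Lc cE cVH cΛ (j + 1) κ u) κ u +
        (fun κ u => (cVH * wVH d Lc (j + 1)) • mfNeg (vhS d Lc κ u)) κ u) +
      (fun κ u => (cΛ * wΛ d Lc (j + 1)) •
          SLam Lc (lamCoeffK (KInvStep (d := d) Lc (j + 1)) (E2 d Lc (j + 1)) Lc) (fun μ y => hessFF Lc μ y) κ u) κ u := rfl
  rw [h, unitS_add, unitS_add]

omit [NeZero Lc] in
/-- [folklore] `sfStep Lc 0 = 1`. -/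
theorem sfStep_zero : sfStep Lc 0 = 1 := by simp [sfStep]

omit [NeZero Lc] in
/-- [folklore] `smStep d Lc 0 = 1`. -/
theorem smStep_zero : smStep d Lc 0 = 1 := by simp [smStep]

omit [NeZero Lc] in
/-- [folklore] Member `0` is read in unit `1`: `unitS (sfStep Lc 0) (smStep d Lc 0) S = S`. -/
theorem unitS_step_zero (S : Fin (d + 1) → (Fin (d + 1) → ℤ) → MKer (d + 1) (Fib d)) :
    unitS (sfStep Lc 0) (smStep d Lc 0) S = S := by
  rw [sfStep_zero, smStep_zero, unitS_one]

/-! ## §2 The uniform half of the S-slot for the members `≥ 1`, from `UnitDecayK` and the located shape «E3Shape» -/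

/-- [folklore] **MEMBERS `≥ 1`: `j`-UNIFORM LOCALITY OF THE NORMALISED STEP STENCILS** from the K-slot's decay half and the located shape:
one `j`-free constant, rate `min δ₃ (δ/4)`. -/
theorem locStencil_unitS_Sstep_succ (hLc : 1 ≤ Lc) {C δ : ℝ} (hK : UnitDecayK d Lc (sfStep Lc) (smStep d Lc) C δ) (hδ : 0 < δ)
    {cE cVH cΛ C₃ δ₃ : ℝ}
    (hE3 : ∀ j : ℕ, LocStencil (unitS (sfStep Lc (j + 1)) (smStep d Lc (j + 1))
      (fun κ u => (cE * wE d Lc (j + 1)) • e3Of d Lc cE cVH cΛ (j + 1) κ u)) C₃ δ₃) (hδ₃ : 0 < δ₃) (j : ℕ) :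
    LocStencil (unitS (sfStep Lc (j + 1)) (smStep d Lc (j + 1)) (Sstep d Lc cE cVH cΛ (j + 1)))
      (C₃ + |cVH| * (3 * (ell (d + 1) Lc : ℝ) ^ 2 * Real.exp (4 * ((d : ℝ) + 1) * Lc * min δ₃ (δ / 2 / 2))) +
        |cΛ * (Lc : ℝ) ^ (2 * (d + 1))| *
          ((d + 1 : ℕ) * (((Fintype.card (Fib d) : ℝ) * (C * C) * Zl (d + 1) (δ - δ / 2)) *
            (2 * (ell (d + 1) Lc : ℝ) ^ 2 * Real.exp (4 * ((d : ℝ) + 1) * Lc * (δ / 2))) * Zl (d + 1) (δ / 2 / 2))))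
      (min δ₃ (δ / 2 / 2)) := by
  set δm : ℝ := min δ₃ (δ / 2 / 2) with hδm
  have hδm0 : 0 < δm := lt_min hδ₃ (by positivity)
  have hC : 0 ≤ C := (hK 0).nonneg (Sum.inl 0)
  -- the three summands at the common rate δm
  have h1 : LocStencil (unitS (sfStep Lc (j + 1)) (smStep d Lc (j + 1))
      (fun κ u => (cE * wE d Lc (j + 1)) • e3Of d Lc cE cVH cΛ (j + 1) κ u)) C₃ δm :=
    locStencil_mono' (hE3 j) le_rfl (min_le_left δ₃ (δ / 2 / 2))
  have h2 := locStencil_unitS_vhPiece (d := d) hLc cVH hδm0.le (j + 1)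
  have h3 := locStencil_mono' (locStencil_unitS_lamPiece (d := d) hLc hK hδ cΛ j) le_rfl (min_le_right δ₃ (δ / 2 / 2))
  rw [unitS_Sstep_succ_eq]
  exact StepJetData.locStencil_add (StepJetData.locStencil_add h1 h2) h3

/-! ## §3 The wall's binder shape `hS` for the whole family `JsBal⁰` (member `0` = `S₀` joins with its own constant) -/

/-- **THE S-SLOT's UNIFORM HALF AS A FUNCTION OF THE K-SLOT AND ONE LOCATED SHAPE** [folklore assembly]: from the wall's own `hK` in the
adopted units (`UnitDecayK d Lc (sfStep Lc) (smStep d Lc) C δ`, `0 < δ`) and the hypothesis «E3Shape» (`hE3`, `0 < δ₃`), for ANY second-order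
tables `W` (they do not enter the stencils): `∃ Cs δS, 0 < δS ∧ ∀ j, LocStencil (unitS (sfStep Lc j) (smStep d Lc j) (JsBal0Of … j).S) Cs δS` —
LITERALLY the binder `hS` of `HessKerDressedUnitsWall.d1Drift_JsBalOf_iff_of_cauchy_unit` at `sf := sfStep Lc`, `sm := smStep d Lc`. -/
theorem hS_of_shapes (hLc : 1 ≤ Lc) {C δ : ℝ} (hK : UnitDecayK d Lc (sfStep Lc) (smStep d Lc) C δ) (hδ : 0 < δ)
    {cE cVH cΛ C₃ δ₃ : ℝ}
    (hE3 : ∀ j : ℕ, LocStencil (unitS (sfStep Lc (j + 1)) (smStep d Lc (j + 1))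
      (fun κ u => (cE * wE d Lc (j + 1)) • e3Of d Lc cE cVH cΛ (j + 1) κ u)) C₃ δ₃) (hδ₃ : 0 < δ₃)
    (W : ℕ → Fin (d + 1) → (Fin (d + 1) → ℤ) → Fin (d + 1) → (Fin (d + 1) → ℤ) → MKer (d + 1) (Fib d))
    (Cw δw : ℕ → ℝ) (hδw : ∀ j, 0 < δw j) (hW : ∀ j, VertexFamily₂ (W j) Lc (Cw j) (δw j)) :
    ∃ Cs δS : ℝ, 0 < δS ∧ ∀ j, LocStencil (unitS (sfStep Lc j) (smStep d Lc j) (JsBal0Of hLc cE cVH cΛ W Cw δw hδw hW j).S) Cs δS := by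
  obtain ⟨C₀, δ₀, hδ₀, h0⟩ := locStencil_S0 (d := d) (Lc := Lc) hLc cE cVH cΛ
  have hC₀ : 0 ≤ C₀ := (h0 0 0).nonneg (Sum.inl 0)
  -- the uniform constant of the members ≥ 1
  set C₁ : ℝ := C₃ + |cVH| * (3 * (ell (d + 1) Lc : ℝ) ^ 2 * Real.exp (4 * ((d : ℝ) + 1) * Lc * min δ₃ (δ / 2 / 2))) +
        |cΛ * (Lc : ℝ) ^ (2 * (d + 1))| *
          ((d + 1 : ℕ) * (((Fintype.card (Fib d) : ℝ) * (C * C) * Zl (d + 1) (δ - δ / 2)) *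
            (2 * (ell (d + 1) Lc : ℝ) ^ 2 * Real.exp (4 * ((d : ℝ) + 1) * Lc * (δ / 2))) * Zl (d + 1) (δ / 2 / 2))) with hC₁
  have hsucc : ∀ j, LocStencil (unitS (sfStep Lc (j + 1)) (smStep d Lc (j + 1)) (Sstep d Lc cE cVH cΛ (j + 1))) C₁ (min δ₃ (δ / 2 / 2)) :=
    fun j => locStencil_unitS_Sstep_succ hLc hK hδ hE3 hδ₃ j
  have hC₁0 : 0 ≤ C₁ := ((hsucc 0) 0 0).nonneg (Sum.inl 0)
  have hm0 : 0 < min δ₃ (δ / 2 / 2) := lt_min hδ₃ (by positivity)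
  refine ⟨max C₀ C₁, min δ₀ (min δ₃ (δ / 2 / 2)), lt_min hδ₀ hm0, fun j => ?_⟩
  cases j with
  | zero =>
      rw [JsBal0Of_S_zero, unitS_step_zero]
      exact locStencil_mono' h0 (le_max_left _ _) (min_le_left _ _)
  | succ j =>
      rw [JsBal0Of_S_succ]
      exact locStencil_mono' (hsucc j) (le_max_right _ _) (min_le_right _ _)

end Family

end Summit.QuantumFields.BalabanUV.Beta.GAN24.StencilSlotOfShapes

end
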